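import Summits.QuantumFields.QCD.Theses.HeatSlicedQuarks
import Summits.QuantumFields.QCD.Theses.GradientFlowSpecies
import Summits.QuantumFields.QCD.Theses.EulerDescent
import Literature.MathematicalPhysics.QuantumFieldTheory.QCDTransferMatrix
import Summits.QuantumFields.QCD.Theorems.SpectralDefectExtinctionWindowExtinctionChessboardDeepAsymptotics
import Summits.QuantumFields.QCD.Theorems.RobustYangMillsHandover.Negative.SchemeAsymptotics
import Summits.QuantumFields.QCD.Theorems.HeatSlicedQuarksRobustYangMillsHandoverSpectralResponseBarrier

/-!
# Line `pin-the-infimum` — skeleton (crux-plan, 2026-08-17, gen 1; RESHAPE gen 2 / 2.1 by lead a3; GEN 3 / 3.0.1 (doc) by lead c14; GEN 3.1 (doc only, stubs byte-identical) by lead c15; GEN 3.2 (doc only, stubs byte-identical) by lead c16, 2026-08-17 — see §1 `stub_sigmaTermBound`, §2c, the STATUS note on `stub_spectralDictionary`, and the c15 / c16 infrastructure ledgers at the end of this header)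

Crux `stmt-QuantumFields-8892`,
`Summit.QuantumFields.QCD.Theses.HeatSlicedQuarks.RobustYangMillsHandover := ContinuumQCDExists → QCD`
(re-typed conjunct: `QCDOf N_f` conjoins `reg.IsChiralAtZero`, p117723).  Idea card
`Cruxes/RobustYangMillsHandover/Ideas/pin-the-infimum.md` (ideator r2 k4), triage TRIAGE-r2-{1,2,3} (fail / pass / pass),
line card `Lines/pin-the-infimum.md`.

## The line in one paragraph

Keep X₀'s OWN regularisation `reg` and PIN its `m_crit` at an offset `P` of its own mass axis chosen by order theory
(the landed glue `Theorems/…PinnedThreshold.lean`, p124514: `qcdOf_of_pinnedThreshold`): `P` is either a gapped threshold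
lying at or below an offset `M₁` above which the lattice rate has no uniform floor (then chirality at `P` is free), or the
INFIMUM of the gapped thresholds (then chirality at `P` = "a uniform rate `ε` just above `P` would gap a slab below `P`").
Gaps above `P` are free by the definition of `P` and item 8922 (`stub_heavyHalf`).  The light-quark content is cut into
FOUR registered statements about X₀'s regularisation, two of them SPECTRAL — stated over the tree's finite-volume
transfer-matrix gap `qcdTransferGap` (Literature `QCDTransferMatrix.lean`, Lüscher positivity / boundedness / level
order landed by the StableActionBridge leads) — which is where TRIAGE-r2-2 (C1) and r2-3 (C1′) showed the engine must live:

* `stub_noUniformFloor` (Goldstone input, weakest form): above SOME offset the lattice rate has no uniform positive floor.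
* `stub_diagDom` (comparison principle): degenerate tuples gapped above `M` ⇒ all tuples gapped above `M` (mass
  splittings upward never close the gap; pointwise shadow of `QuarkMassMonotone.LatticeGapMonotone`, 8905).
* `stub_sigmaTermBound` (GEN 3; gen ≤ 2.1 `stub_spectralResponse`, THE BET, engine re-filed as r2-2's (∗)): the
  volume-uniform one-sided a-priori sigma-term bound of the finite-volume transfer gap along the degenerate ray where the
  gap is `≥ (ε/2) a_k` (lowering the common offset by `Δ ≤ ρ` costs `≤ a_k F Δ`).  The fixed-`(k,S)` openness statement it
  replaces — a gap `≥ ε a_k` at ONE degenerate offset `μ` forces `≥ (ε/2) a_k` on `[μ − δ(ε), μ]`, `δ` uniform in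
  `k ≥ k₀(ε)`, `S ≥ L_k`, `μ` — is DERIVED in §2c from it by the landed continuity-of-levels + barrier theorems (p142407,
  p143392).  The moving-front profile of C1 (`g_k(θ) = ε/8 + ε(1 − tanh(k²θ − k))`) satisfies every correlator-level
  Feynman–Hellmann bound and VIOLATES this stub.
* `stub_spectralDictionary` (Disproof §13 debt, now typed): per-pair `HasLatticeMassGap ε` at a tuple ⇔ eventually
  `qcdTransferGap ≥ (ε/2) a_k` on every torus `2S+1 ≥ 2L_k+1` (factor-2 slack both ways): Lüscher's trace formula for the
  tree's time-PERIODIC Berezin functional (supertrace forms landed p129592/p129927/p130563), `(−1)^F`-sector control, and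
  pair-uniformity of the eventual rate for honest lattice QCD.
The two remaining stubs are the bookkeeping EVERY same-regularisation completion of this crux owes (FINDINGS-r2k4 A4,
Disproof §8): `stub_dataBelowZero` (E: X₀-type continuum data at gapped tuples of `reg` above a gapped threshold with a
non-positive component — VACUOUS iff X₀'s witness does not overshoot the chiral point; target-sized otherwise; the clause
restatement R2 deletes) and `stub_gapTransfer` (T: continuum gap of a lattice-gapped honest scheme, the `∃Δ` kernel of 8923).

## Composition

`qcdOf_of_stubs` (explicit hypotheses, sorry-free) and `RobustYangMillsHandover_of : RobustYangMillsHandover` (the ONLY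
theorem of this file concluding the crux; sorries ONLY inside the seven `stub_*`).  `diagonal_opensBelow` derives the
pin's openness input from stubs 3–5; `exists_pin_of_noUniformFloor` is the order-theoretic core with the weak Goldstone
input; `lightPackage_pin` is the E/T-free sub-composition (chirality + lattice gaps of the pinned regularisation from
stubs 1–5 alone) that survives verbatim under restatement R1 (`QuarksAsStableAction.ChiralCompletion`, 17394) or R2.
The `m_crit`-shift and `qcdOf_of_pinBody` repeat, self-contained, the landed glue `qcdOf_of_pinnedThreshold` of
`Theorems/HeatSlicedQuarksRobustYangMillsHandoverPinnedThreshold.lean` (p124514), so that this file imports only the two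
route modules and `QCDTransferMatrix`.

## Disproof.lean used (cdisprove cycles 1–3; `-- Targets`: none; no `_false_without_` theorem exists)

§2 `handoverWithoutNontriviality_iff_qcd`: non-triviality of X₀'s data enters at `stub_noUniformFloor` (for the junk
vacuum witness every tuple is gapped at every rate, `vacuum_hasMassGap'`, and the stub is FALSE — it is the one stub that
spends `IsNontrivial (pseudoRe f g)`), and at `stub_spectralDictionary`/`stub_sigmaTermBound` only through honesty of
the bare parameters.  §6 `hasLatticeMassGap_scheme_indep`: every gap set is read through `reg.scheme t 0 0`.  §8
`continuumQCDExistsOf_iff_threshold`: why `stub_dataBelowZero` exists at all.  §9(ii)/§10/§12: no stub expands in `κ`,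
inverts the fine Dirac operator, or uses configuration-wise positivity of the signed determinant — the spectral stubs are
OPERATOR-side (Lüscher's `T̂` for `m_f > −1`, granted eventually by `IsQCDAlong`).  §13: isolated as `stub_spectralDictionary`.
Landed `Negative/ChiralityObstruction.not_isChiralAtZero_mcrit_shift_of_uniformGapAbove`: respected by construction (the pin
never sits inside a uniformly gapped half-line).  No stub is an instance of a landed Negative lemma or of the five
`ledger negatives` of the summit (14958, 9665, 9494, 9599, 9603).

## Lead c15, cycle 1 (2026-08-17T10:2x–13:5xZ): infrastructure landed towards the two spectral stubs (all `--supports` this crux)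

* FH identity (mechanism (i) of `stub_sigmaTermBound`): item stmt-QuantumFields-8909 `QuarkMassMonotone.MassDerivativeIdentity` CLOSED
  (`Theorems/QuarkMassMonotoneMassDerivativeIdentity.lean`, p157950) from `stub_fermiBoltzmann_update` (p155452) and
  `stub_massDerivativeIdentity_of_update` (p155680; abstract `hasDerivAt_qcdTorusExpect` for any coefficient-regular insertion); the
  flavour-diagonal FH for the CONNECTED correlator (minus the truncated three-point function with `Σ = Σ_f ψ̄_fψ_f`):
  `stub_connectedCorr_massDerivative` (p158772) — the first lemma of the pseudomass plan (GJ §17.5).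
* Dictionary (⇐), mathematics side: M1(b) graded trace of powers of a Hermitian bounded-kernel operator
  (`Literature/Analysis/OperatorTheory/HermitianKernelSpectralTrace.lean`, `…ComplexKernelCyclicPeeling.lean`; `stub_gradedCyclicTrace` p157799),
  sandwiched-insertion trace formula `Tr(B A^{M+4}) = ∫ k_{ABA} K ⋯ K` (`…HermitianKernelSandwichedTrace.lean` p159029; `stub_sandwichedTrace`
  p160337); M1(c) Gauss-law averaging maps continuous waves into the core (`stub_gaugeAverage_mem_transferCore` p156065); the gauge-AVERAGED
  symmetric kernel `k_sym((U,s),(U',s')) = ∫dg K_β(U,U'^g)[R(U)Γ_gR(U')]_{ss'}` is strongly measurable, bounded, Hermitian (`stub_symKernel_regular`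
  p158926), a graded square root `R` exists (`stub_fermionSliceOp_sqrt_graded` p159055), and the configuration-space cyclic SUPERtrace of the
  StableActionBridge leads IS the graded cyclic path integral of `k_sym` (`stub_cyclicSupertrace_eq_symKernelCycle` p158856).
* COORDINATION: crux 9737's line `twisted_trace_transfer` landed E3 (`stub_torusDenominators_spectral`, p157752: both torus denominators as
  twisted/thermal spectral sums `Σ σᵢλᵢ^N`, `λ_{i₀}` = level 0, same kernel).  This line CONSUMES it: `stub_torusDenominators_spectral_levelOne`
  (p161543) adds `∀ i ≠ i₀, λᵢ ≤ qcdTransferLevel … 1` (so `(λᵢ/λ_{i₀})ⁿ ≤ e^{−n·qcdTransferGap}`), and M5 is a THEOREM: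
  `stub_twistedRatio_cluster` (p161128) bounds the connected twisted ratio of two insertions by
  `‖X‖‖X'‖[(1+δ)(ρⁿ(1+δ') + ρ^{N−n}) + 3δ + δ²]/(1−δ)²`, `ρ = e^{−gap}`, `δ = Σ_{i≠i₀}(λᵢ/λ₀)^N`, `δ' = Σ_{i≠i₀}(λᵢ/λ₀)^{N−n}` — isolating
  M6 (vacuum dominance of the twisted trace at the scheme's own extent `N = 2S+1`, = the `LowTemperaturePressure` clause of 9737) as the
  ONLY physics-grade input of (⇐) besides E2.  STILL MISSING for (⇐): E2 = fermionic insertions (quark observables ↦ operators between the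
  𝕋's; route: sources `det(D − sJ)` + the block-cyclic determinant `det_blockDiag_add_blockShift` + `dΓ`), and M6.

## Lead c16, cycle 1 (2026-08-17T13:4x–19:3xZ): E2 FOR EQUAL-TIME QUARK BILINEARS IS DONE THROUGH THE KERNEL LEVEL (21 `--supports` files, five waves of stub-workers; all formulas numerics-validated first)

Route: the SOURCE/DERIVATIVE trick on top of the landed GENERAL-slice-operator chain `det_projChain` (no new Grassmann–Fock dictionary).
* Calculus / Fock bricks: `stub_Gamma_path_hasDerivAt` (p165561: `Γ(γ(s))' = Γ(γ₀)dΓ(γ₀⁻¹γ') = dΓ(γ'γ₀⁻¹)Γ(γ₀)`), `stub_matrix_affine_path_calculus`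
  (p166282: `(E−sK)⁻¹`, Jacobi, eventual invertibility), `stub_oneStep_path_hasDerivAt` (p168876), `stub_supertrace_prod_hasDerivAt` (p169124; RESHAPED `t₀ < T`),
  `stub_Gamma_conj_dGamma` (p169321: `Γ(g)dΓ(Y)Γ(g)⁻¹ = dΓ(gYg⁻¹)`, parity of `dΓ`), `stub_supertrace_undress_insert` (p167187: STr undressing with arbitrary
  slot insertions), `stub_chainBlock_insertion_algebra` (p166753: `M'M'ᵢ = 1`, `N Nᵢ = 1`, the link-free insertion identity, `tr(ẼJP⁻) = tr(J Bh⁻¹P⁻)`).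
* F1 `stub_projChain_det_hasDerivAt_source` (p170584): for GENERAL slice operators, `d/ds|₀ det chain[A_{t₀} − sJ] = (∏det E_t)·STr[∏_i (𝒥_i Γ(N_i))]`,
  `𝒥_{t₀} = dΓ(E⁻¹J(P⁻ − P⁺F⁻¹E)) − tr(E⁻¹JP⁻)·1`; F4-a `stub_projChain_det_two_sources` (p171324: two sources, `t₁ ≠ t₂`, mixed second derivative =
  two insertions); F2 `stub_wilsonChain_undress_insertion` (p170803: Wilson `A = Bh + C`: the insertion becomes LINK-FREE,
  `𝒦 = dΓ(K_J) − tr(J Bh⁻¹ P⁻)`, `K_J = (−P⁺ + P⁺C Bh⁻¹P⁻ + Bh⁻¹P⁻) J (P⁻ + P⁺M'⁻¹)`).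
* QCD dictionary (N_f flavours, flavour-OFF-diagonal sources allowed: chain on `(Fin Nf × TorusSite 3 L) × Fin 3 × Fin 4`): `stub_diracMatrix_source_timeSlice` (p167987),
  `stub_diracMatrix_multiSource_timeSlice` (p171399), `stub_flavourChain_slice_dictionary` (p169597), `stub_flavourChain_dressedCore` (p169859: `M'_t = V M_F(U_t) V⁻¹`,
  `det E_t = det A(U_t)²`), `stub_sliceData_continuous` (p170833), `stub_local_bilinear_eq_quadratic` (p168579: mesons / `pseudoscalarBilinear` are `quadratic`s),
  `stub_fermiIntegral_sources_det` (p168275: `∫e^{−ψ̄Mψ} = ε det M`, one/two-source Berezin derivative identities).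
* DELIVERABLES (per background `U`, masses `> −1`): `stub_det_diracMatrix_source_hasDerivAt_smit` (p171220: `d/ds|₀ det(D(U) − sJ^{(t₀)}) =
  STr[∏_i (𝒦_i · T̂_F(U_i)Γ(G_{g_i}))]` in the capstone-B product, `𝒦_{t₀} = dΓ(V⁻¹K̂_J V) − tr(Ĵ Â⁻¹P̂⁻)·1` from slice-t₀ data only),
  `stub_det_diracMatrix_two_sources_smit` (p171896: two sources + `∫(ψ̄J₂ψ)_{t₂}(ψ̄J₁ψ)_{t₁}e^{−ψ̄Dψ} = ε·STr[two insertions]` — the per-background MESON NUMERATOR),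
  `stub_fermiIntegral_bilinear_cyclic_supertrace` (p172168: one-bilinear Berezin identity + its Haar-weighted gauge integral = capstone C's cyclic kernel supertrace
  with one insertion `ins(p.1 t₀, Jh)`; transport by `measurableEmbedding_timeAssemble`).
* STILL MISSING for (⇐): (δ) scalarise-with-insertions (bond kernel entering `t₀` becomes `R B 𝒦 R` = kernel of `A∘M`, `M` = fibrewise `R⁻¹𝒦R`) + 9737's
  `stub_spectralTraceInsertC` ⇒ spectral double sums ⇒ M5; S-uniform bounds on `‖M‖` for local `J`; general `QCDLatticeObservable` (quartics, same-time products,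
  baryons) = higher mixed derivatives / Fock dictionary (XL); and M6 (physics).
-/

namespace Summit.QuantumFields.QCD.Cruxes.RobustYangMillsHandover.PinTheInfimum

open Summit.QuantumFields.QCD.Theses.HeatSlicedQuarks
open Literature.MathematicalPhysics.QuantumFieldTheory
open Filter

variable {Nf : ℕ}

/-! ## §0 Vocabulary (two data-valued abbreviations over tree declarations) -/

/- Vocabulary used INLINE below (no Prop-valued definitions in this file, so that the tree audit sees only registered
obligations):  "X₀ data of `reg`" := `∀ m, (∀ f, 0 < m f) → ∃ z shift T, IsQCDAlong (reg.scheme m z shift) T ∧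
T.IsNontrivial glue ∧ T.IsNonGaussian glue ∧ ∀ f ≠ g, T.IsNontrivial (pseudoRe f g)` (the body of `ContinuumQCDExists`
after `reg.HasMassScaling`);  "`t` is gapped" := `∃ Δ > 0, (reg.scheme t 0 0).HasLatticeMassGap Δ` (SOME positive rate,
per-pair clause of the Statement). -/

/-- The degenerate (flavour-symmetric) offset tuple `(μ, …, μ)`. [folklore] -/
def diagTuple (Nf : ℕ) (μ : ℝ) : Fin Nf → ℝ := fun _ => μ

/-- **The finite-volume transfer-matrix gap of `reg` at the offset tuple `t`, step `k`, torus side `2S+1`** (lattice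
units): the tree's `qcdTransferGap` (Lüscher's positive transfer matrix, min–max levels on the gauge-invariant subspace)
at the scheme's own coupling `β_k` and bare masses `m_crit(k) + a_k t_f / Z_m(k)`. [folklore] -/
noncomputable def transferGapAt (reg : QCDRegularisation Nf) (t : Fin Nf → ℝ) (k S : ℕ) : ℝ :=
  qcdTransferGap Nf (reg.β k) (2 * S + 1) (fun f => (reg.scheme t 0 0).mq f k)

/-! ## §1 The seven registered stubs (the only `sorry`s of the line) -/

/-- **stub_heavyHalf — the heavy-threshold lattice half, BY NAME** (item stmt-QuantumFields-8922,
`GradientFlowSpecies.MassiveLatticeGap`): every X₀-honest regularisation has a threshold above which every tuple is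
lattice-gapped at some rate.  Open problem (lattice Yang–Mills gap in physical units along `β_k → ∞` + heavy-quark
decoupling); shared with every other line of this crux; size XL. -/
theorem stub_heavyHalf : Summit.QuantumFields.QCD.Theses.GradientFlowSpecies.MassiveLatticeGap := by
  sorry

/-- **stub_noUniformFloor — the Goldstone input in its weakest form**: for the regularisation X₀ hands over there is an
offset `M₁` such that for every rate `ε > 0` some tuple above `M₁` is NOT uniformly `ε`-gapped — arbitrarily light states
occur somewhere on X₀'s own bare family ("the flavour-blind critical line of `reg` sits at a finite renormalised offset and
the gap closes there": Goldstone pions / anomaly matching for `N_f = 2, 3`).  Strictly weaker than "one tuple carries no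
positive rate" (see the `example` of §4).  This is where X₀'s NON-TRIVIALITY is spent (false for the vacuum
witness of Disproof §2).  Size L–XL (no weak-coupling lattice proof of Goldstone gaplessness exists). -/
theorem stub_noUniformFloor :
    ∀ Nf : ℕ, Nf = 2 ∨ Nf = 3 → ∀ reg : QCDRegularisation Nf, reg.HasMassScaling →
      (∀ m : Fin Nf → ℝ, (∀ f, 0 < m f) → ∃ (z shift : QCDField Nf → ℕ → ℝ) (T : OSData (QCDField Nf) 4),
          IsQCDAlong (reg.scheme m z shift) T ∧ T.IsNontrivial QCDField.glue ∧ T.IsNonGaussian QCDField.glue ∧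
            ∀ f g : Fin Nf, f ≠ g → T.IsNontrivial (QCDField.pseudoRe f g)) →
      ∃ M₁ : ℝ, ∀ ε > (0 : ℝ), ∃ t : Fin Nf → ℝ, (∀ f, M₁ < t f) ∧ ¬ (reg.scheme t 0 0).HasLatticeMassGap ε := by
  sorry

/-- **stub_diagDom — diagonal domination (comparison principle, pointwise):** for X₀'s regularisation, if every
DEGENERATE tuple `(μ, …, μ)` with `μ > M` is lattice-gapped at some rate then every tuple with all offsets `> M` is —
raising quark masses above a gapped flavour-symmetric floor never closes the lattice gap (heavier flavours raise every
induced scale, `Λ₂ = Λ₃^{27/29} m_s^{2/29}`; Vafa–Witten: no parity/flavour transition at positive masses; the additive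
critical mass is asymptotically flavour-blind).  Pointwise shadow of `QuarkMassMonotone.LatticeGapMonotone`
(stmt-QuantumFields-8905, rate-preserving, with a physical-branch certificate).  This is where the mass-HIERARCHY corner of
FINDING-thresholds-ratios is discharged (the response stub below is uniform only along the degenerate ray).  Size L. -/
theorem stub_diagDom :
    ∀ Nf : ℕ, Nf = 2 ∨ Nf = 3 → ∀ reg : QCDRegularisation Nf, reg.HasMassScaling →
      (∀ m : Fin Nf → ℝ, (∀ f, 0 < m f) → ∃ (z shift : QCDField Nf → ℕ → ℝ) (T : OSData (QCDField Nf) 4),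
          IsQCDAlong (reg.scheme m z shift) T ∧ T.IsNontrivial QCDField.glue ∧ T.IsNonGaussian QCDField.glue ∧
            ∀ f g : Fin Nf, f ≠ g → T.IsNontrivial (QCDField.pseudoRe f g)) →
      ∀ M : ℝ, (∀ μ : ℝ, M < μ → (∃ Δ > (0 : ℝ), (reg.scheme (diagTuple Nf μ) 0 0).HasLatticeMassGap Δ)) →
        ∀ t : Fin Nf → ℝ, (∀ f, M < t f) → (∃ Δ > (0 : ℝ), (reg.scheme t 0 0).HasLatticeMassGap Δ) := by
  sorry

/-- **stub_sigmaTermBound (gen 3; was `stub_spectralResponse`) — THE BET, reduced to its a-priori half: the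
volume-uniform one-sided sigma-term bound on the finite-volume transfer gap along the degenerate ray.**  For X₀'s
regularisation and every rate `ε > 0` there are `F, ρ > 0` such that eventually in `k`, on every torus `2S+1 ≥ 2L_k+1`,
LOWERING the common renormalised offset by `Δ ≤ ρ` from a range-guarded degenerate point `ν` whose transfer gap is
`≥ (ε/2) a_k` costs at most `a_k F Δ` of gap: `g_{k,S}(ν) − a_k F (ν − ν') ≤ g_{k,S}(ν')` for `ν' ≤ ν`, `ν − ν' ≤ ρ` —
mechanism step (i) of the old response stub (the vacuum-subtracted sigma term of the low-lying states in the
RENORMALISED scalar density `(a_k/Z_m)Σψ̄ψ`; physically `F ≈ 2B̄/ε + CΛ`; `QuarkMassMonotone.MassDerivativeIdentity`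
8909 is the finite-`(β,S)` Feynman–Hellmann identity behind it).  Steps (ii) continuity of the min–max levels in the
bare mass and (iii) the barrier argument are THEOREMS now (`qcdTransferGap_continuousOn_mass` p142407,
`spectralResponse_of_sigmaTermBound` p143392, lead a3), so the fixed-`(k,S)` openness statement of gen ≤ 2.1
(`stub_spectralResponse`) is DERIVED below (§2c `spectralResponse_of_stub`) with `δ = ε/(2F)`.  RANGE GUARD as
before: claimed only where Lüscher's transfer matrix is the honest positive operator (`β_k ≥ 0`, bare masses `> −1` at
the lower point `ν'`), inside which `transferGapAt` is an honest non-negative continuous function of the offset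
(`qcdTransferLevel_one_pos` p140612).  Content: no first-order drop of the `T = 0`, `θ = 0` finite-volume QCD gap in
the COMMON quark mass from a gapped point, uniformly in the volume and in `k ≥ k₀(ε)` — open physics (volume-uniform
control of an extensive perturbation of an interacting gapped transfer matrix; no BHM/NSY-type theorem applies off
frustration-free references, Disproof §11).  Size XL. -/
theorem stub_sigmaTermBound :
    ∀ Nf : ℕ, Nf = 2 ∨ Nf = 3 → ∀ reg : QCDRegularisation Nf, reg.HasMassScaling →
      (∀ m : Fin Nf → ℝ, (∀ f, 0 < m f) → ∃ (z shift : QCDField Nf → ℕ → ℝ) (T : OSData (QCDField Nf) 4),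
          IsQCDAlong (reg.scheme m z shift) T ∧ T.IsNontrivial QCDField.glue ∧ T.IsNonGaussian QCDField.glue ∧
            ∀ f g : Fin Nf, f ≠ g → T.IsNontrivial (QCDField.pseudoRe f g)) →
      ∀ ε > (0 : ℝ), ∃ F > (0 : ℝ), ∃ ρ > (0 : ℝ), ∀ᶠ k in atTop, ∀ S : ℕ, reg.L k ≤ S → ∀ ν ν' : ℝ,
        0 ≤ reg.β k → (∀ f, -1 < (reg.scheme (diagTuple Nf ν') 0 0).mq f k) → ν' ≤ ν → ν - ν' ≤ ρ →
          ε / 2 * reg.a k ≤ transferGapAt reg (diagTuple Nf ν) k S →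
            transferGapAt reg (diagTuple Nf ν) k S - reg.a k * F * (ν - ν') ≤
              transferGapAt reg (diagTuple Nf ν') k S := by
  sorry

/-- **stub_spectralDictionary (gen 2.1) — the per-tuple Lüscher range (P) plus the per-pair ↔ transfer-matrix dictionary.**
RESHAPE (lead a3; wave-1 verdict `stub-misstated`, wave-2 refinement): gen 1 carried a clause (R) `∀ t, ∀ᶠ k, 0 ≤ β_k ∧
∀ f, −1 < m_f(k)` at EVERY offset tuple; its mass half at tuples with a non-positive component follows from no hypothesis
(X₀ bounds `m_crit` only through `−1 < m_crit(k) + a_k m/Z_m(k)` at positive `m` — formal witness `canonicalAF` with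
`m_crit ≡ −1`, evidence `stub_spectralDictionary.lean`); gen 2 stated a margin `∃ η > 0, ∀ᶠ k, η − 1 ≤ m_crit(k)`, which is
strictly STRONGER than what the composition consumes (witness `m_crit(k) = −1 + √(a_k/Z_m(k))`, evidence
`stub_spectralDictionary_gen2.lean`).  Gen 2.1 states exactly the consumed content as the first conjunct, the PER-TUPLE
range (P) `∀ t f, ∀ᶠ k, −1 < m_f^{(t)}(k)` (⇔ `(m_crit(k)+1) Z_m(k)/a_k → +∞`: the critical mass stays above Lüscher's
endpoint `κ = 1/6` by more than every fixed renormalised offset — physically `m_crit(k) → 0⁻`), from which the skeleton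
derives the whole range guard (`rangeGuard_of_perTuple`: `β_k → +∞` by asymptotic scaling).  Honesty of `transferGapAt`
inside the guard is now a THEOREM: `0 < λ₁` (`Theorems/…TransferLevelOnePos.lean`, `qcdTransferGap_eq_neg_log_div`, lead a3).
Original description — **the per-pair lattice gap clause IS an eventual transfer-matrix gap bound, both ways,
with factor-2 slack** (Disproof §13's quantifier wall, isolated and typed; the companion statement the docstring of
`qcdTransferGap` asks to be filed): for X₀'s regularisation and any offset tuple `t`, (R) eventually in `k` the scheme's
coupling is `β_k ≥ 0` and its bare masses at `t` lie in Lüscher's range `m_f(k) > −1` (an HONEST witness sits at a finite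
renormalised distance from the true critical line, `β_k → ∞` by asymptotic scaling, `κ_f(k) → (1/8)⁺`, cf.
`Negative.HoppingWindow`; for the vacuum/`canonicalAF` junk witness it holds trivially), (⇒) `HasLatticeMassGap ε` at `t`
gives, eventually in `k`, `qcdTransferGap ≥ (ε/2) a_k` on every torus of side `2S+1 ≥ 2L_k+1` (pair-UNIFORMITY of the
eventual per-pair rate: a state below `(ε/2)a_k` at a large step `k` is seen by some fixed small gauge-invariant pair at
time separations `n ≤ S`, `S → ∞` being available at fixed `k`; physics, not bookkeeping), and (⇐) an eventual bound
`qcdTransferGap ≥ ε a_k` on all those tori gives `HasLatticeMassGap (ε/2)` (Lüscher's trace formula for the tree's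
time-PERIODIC functional `qcdTorusExpect` = `(−1)^F`-twisted trace — supertrace transfer forms landed p129592 / p129927 /
p130563 — plus wrap-around and fermion-odd-sector control on odd tori).  Size XL (infrastructure shared with 8923, 17718
and route QuarkMassMonotone; (R) is the only clause that reads the bare trajectory itself).  STATUS after lead c14 cycle 1
(FINDING-c14-cycle1): the operator side M2 of (⇐) is LANDED (`transfer_cluster`, p152624: the n-step transfer forms cluster at
rate `qcdTransferLevel 1 / qcdTransferLevel 0`); (⇐) still needs M1 (Lüscher trace formula with quark insertions: after lead c15 cycle 1 only E2 = FERMIONIC insertions is missing;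
denominators E3 + level-1 bound and the twisted-ratio algebra M5 are THEOREMS) and — load-bearing at the scheme's OWN volumes `S = L_k`,
where the time-periodic functional is a finite-temperature twisted trace — M6: vacuum dominance `Σ_{i≠0}(λᵢ/λ₀)^{2S+1} → 0` needs `ε a_k L_k ≫ 3 log L_k` (not implied by `a_k L_k → ∞`) or a
locality / density-of-states bound; spectral data (gap + Hilbert–Schmidt norm `~e^{cS³}`) cannot supply it. -/
theorem stub_spectralDictionary :
    ∀ Nf : ℕ, Nf = 2 ∨ Nf = 3 → ∀ reg : QCDRegularisation Nf, reg.HasMassScaling →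
      (∀ m : Fin Nf → ℝ, (∀ f, 0 < m f) → ∃ (z shift : QCDField Nf → ℕ → ℝ) (T : OSData (QCDField Nf) 4),
          IsQCDAlong (reg.scheme m z shift) T ∧ T.IsNontrivial QCDField.glue ∧ T.IsNonGaussian QCDField.glue ∧
            ∀ f g : Fin Nf, f ≠ g → T.IsNontrivial (QCDField.pseudoRe f g)) →
      (∀ t : Fin Nf → ℝ, ∀ f, ∀ᶠ k in atTop, -1 < (reg.scheme t 0 0).mq f k) ∧
        ∀ t : Fin Nf → ℝ, ∀ ε : ℝ, 0 < ε →
          ((reg.scheme t 0 0).HasLatticeMassGap ε →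
              ∀ᶠ k in atTop, ∀ S : ℕ, reg.L k ≤ S → ε / 2 * reg.a k ≤ transferGapAt reg t k S) ∧
            ((∀ᶠ k in atTop, ∀ S : ℕ, reg.L k ≤ S → ε * reg.a k ≤ transferGapAt reg t k S) →
              (reg.scheme t 0 0).HasLatticeMassGap (ε / 2)) := by
  sorry

/-- **stub_dataBelowZero (gen 2) — E BY NAME: item stmt-QuantumFields-16903
`EulerDescent.RetypedContinuumComplement`.**  RESHAPE (lead a3, wave-1 verdict `stub-blocked: 16903`): gen 1 asked, for
X₀'s regularisation, for honest continuum data at every tuple above a gapped threshold `P` with SOME component `≤ 0` —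
a target-sized same-regularisation existence debt with no supplier as typed (8870/17394 are `∃ reg`).  Item 16903 (open
crux of route EulerDescent, rank 5, XL) supplies it after the `m_crit`-shift by an offset `P' ∈ (P, min_f t_f)`: the
shifted regularisation has mass scaling, asymptotic scaling (any X₀ datum), `m_crit > −1` eventually (the range guard
at the degenerate tuple `P'`, from clause (P) of `stub_spectralDictionary`), a heavy anchor (X₀ data + lattice gaps above
`P` + `stub_gapTransfer`) and pointwise lattice gaps at all its positive tuples — so 16903 returns the full body there
(`dataBelowZero_of_complement`, §2b, sorry-free).  VACUOUS, as before, unless X₀'s witness overshoots its chiral point.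
Size XL (another route's crux, by name — recorded, not hidden). -/
theorem stub_dataBelowZero : Summit.QuantumFields.QCD.Theses.EulerDescent.RetypedContinuumComplement := by
  sorry

/-- **stub_gapTransfer — T, continuum gap of a lattice-gapped honest scheme** (the `∃Δ` kernel of item
stmt-QuantumFields-8923 `GradientFlowSpecies.GapTransfer`, restricted to X₀'s regularisation and to the species
renormalisations that carry `IsQCDAlong` data; a prover may instead deliver `HasSpeciesCSClustering` and use the landed
`IsQCDAlong.hasMassGap_of_hasSpeciesCSClustering`, or go through `stub_spectralDictionary`).  Size L. -/
theorem stub_gapTransfer :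
    ∀ Nf : ℕ, Nf = 2 ∨ Nf = 3 → ∀ reg : QCDRegularisation Nf, reg.HasMassScaling →
      (∀ m : Fin Nf → ℝ, (∀ f, 0 < m f) → ∃ (z shift : QCDField Nf → ℕ → ℝ) (T : OSData (QCDField Nf) 4),
          IsQCDAlong (reg.scheme m z shift) T ∧ T.IsNontrivial QCDField.glue ∧ T.IsNonGaussian QCDField.glue ∧
            ∀ f g : Fin Nf, f ≠ g → T.IsNontrivial (QCDField.pseudoRe f g)) →
      ∀ (t : Fin Nf → ℝ) (z shift : QCDField Nf → ℕ → ℝ) (T : OSData (QCDField Nf) 4),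
        IsQCDAlong (reg.scheme t z shift) T → (∃ Δ > (0 : ℝ), (reg.scheme t 0 0).HasLatticeMassGap Δ) →
          ∃ Δ > (0 : ℝ), T.HasMassGap Δ := by
  sorry

/-! ## §2 The `m_crit`-shift and `QCDOf` at a pin (self-contained copy of the landed glue p124514) -/

/-- The `m_crit`-shift of a regularisation by the renormalised offset `P` (masses `m` of the shift are offsets `P + m`).
[folklore] -/
noncomputable def shiftReg (reg : QCDRegularisation Nf) (P : ℝ) : QCDRegularisation Nf :=
  { reg with mcrit := fun k => reg.mcrit k + reg.a k * P / reg.Zm k }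

/-- The shifted scheme at `m` IS the original scheme at `P + m`. [folklore] -/
theorem shiftReg_scheme (reg : QCDRegularisation Nf) (P : ℝ) (m : Fin Nf → ℝ)
    (z shift : QCDField Nf → ℕ → ℝ) :
    (shiftReg reg P).scheme m z shift = reg.scheme (fun f => P + m f) z shift := by
  simp only [shiftReg, QCDRegularisation.scheme, QCDScheme.mk.injEq, true_and, and_true]
  funext f k
  ring

/-- The shift keeps `HasMassScaling` (which never reads `m_crit`). [folklore] -/
theorem shiftReg_hasMassScaling_iff (reg : QCDRegularisation Nf) (P : ℝ) :
    (shiftReg reg P).HasMassScaling ↔ reg.HasMassScaling :=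
  Iff.rfl

/-- **Chirality of the shift by `P` IS "no uniform lattice rate just above `P`".** [folklore] -/
theorem isChiralAtZero_shiftReg_iff (reg : QCDRegularisation Nf) (P : ℝ) :
    (shiftReg reg P).IsChiralAtZero ↔
      ∀ ε > (0 : ℝ), ∃ t : Fin Nf → ℝ, (∀ f, P < t f) ∧ ¬ (reg.scheme t 0 0).HasLatticeMassGap ε := by
  unfold QCDRegularisation.IsChiralAtZero
  simp only [shiftReg_scheme]
  constructor
  · intro h ε hε
    obtain ⟨m, hm, hng⟩ := h ε hε
    exact ⟨fun f => P + m f, fun f => by linarith [hm f], hng⟩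
  · intro h ε hε
    obtain ⟨t, ht, hng⟩ := h ε hε
    refine ⟨fun f => t f - P, fun f => by linarith [ht f], ?_⟩
    have ht' : (fun f => P + (t f - P)) = t := funext fun f => by ring
    rwa [ht']

/-- The lattice gap clause is antitone in the rate. [folklore] -/
theorem hasLatticeMassGap_of_le (sch : QCDScheme Nf) {Δ Δ' : ℝ} (hle : Δ ≤ Δ')
    (h : sch.HasLatticeMassGap Δ') : sch.HasLatticeMassGap Δ := by
  intro R R' A B
  obtain ⟨C, hC⟩ := h R R' A B
  refine ⟨C, ?_⟩
  filter_upwards [hC] with k hk S hS n hn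
  refine (hk S hS n hn).trans ?_
  have hC0 : 0 ≤ C := by
    have h1 := (norm_nonneg _).trans (hk S hS n hn)
    exact nonneg_of_mul_nonneg_left h1 (Real.exp_pos _)
  refine mul_le_mul_of_nonneg_left (Real.exp_le_exp.mpr ?_) hC0
  have : 0 ≤ sch.a k * n := mul_nonneg (sch.a_pos k).le (Nat.cast_nonneg n)
  nlinarith

/-- The continuum gap clause is antitone in the rate. [folklore] -/
theorem hasMassGap_of_le {ι : Type} {d : ℕ} [NeZero d] (T : OSData ι d) {Δ Δ' : ℝ} (hle : Δ ≤ Δ')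
    (h : T.HasMassGap Δ') : T.HasMassGap Δ := by
  intro n m k k' F G hF hG
  obtain ⟨C, hC⟩ := h n m k k' F G hF hG
  refine ⟨C, fun t ht H hH => (hC t ht H hH).trans ?_⟩
  have hC0 : 0 ≤ C := by
    have h1 := (norm_nonneg _).trans (hC t ht H hH)
    exact nonneg_of_mul_nonneg_left h1 (Real.exp_pos _)
  exact mul_le_mul_of_nonneg_left (Real.exp_le_exp.mpr (by nlinarith)) hC0

/-- **`QCDOf N_f` at a pin** (the landed `qcdOf_of_pinnedThreshold`, p124514, in the form consumed here): a mass-scaling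
regularisation `reg` and an offset `P` such that (χ) the `m_crit`-shift by `P` is chiral at zero and (D) honest continuum
data, a continuum gap and a lattice gap (of `reg.scheme t 0 0`) exist at every tuple above `P` witness the re-typed
conjunct through that shift. [folklore] -/
theorem qcdOf_of_pin (reg : QCDRegularisation Nf) (hMS : reg.HasMassScaling) (P : ℝ)
    (hχ : (shiftReg reg P).IsChiralAtZero)
    (hD : ∀ t : Fin Nf → ℝ, (∀ f, P < t f) →
      ∃ (z shift : QCDField Nf → ℕ → ℝ) (T : OSData (QCDField Nf) 4),
        IsQCDAlong (reg.scheme t z shift) T ∧ T.IsNontrivial QCDField.glue ∧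
          T.IsNonGaussian QCDField.glue ∧
            (∀ f g : Fin Nf, f ≠ g → T.IsNontrivial (QCDField.pseudoRe f g)) ∧
              (∃ Δ > (0 : ℝ), T.HasMassGap Δ) ∧ (∃ Δ > (0 : ℝ), (reg.scheme t 0 0).HasLatticeMassGap Δ)) :
    QCDOf Nf := by
  refine ⟨shiftReg reg P, (shiftReg_hasMassScaling_iff reg P).mpr hMS, hχ, fun m hm => ?_⟩
  obtain ⟨z, shift, T, hA, hN, hG, hPs, ⟨Δ₁, hΔ₁, hT⟩, Δ₂, hΔ₂, hL⟩ :=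
    hD (fun f => P + m f) (fun f => by linarith [hm f])
  refine ⟨z, shift, T, ?_, hN, hG, hPs, min Δ₁ Δ₂, lt_min hΔ₁ hΔ₂,
    hasMassGap_of_le T (min_le_left _ _) hT, ?_⟩
  · rw [shiftReg_scheme]; exact hA
  · rw [shiftReg_scheme]
    -- the lattice clause never reads the species renormalisations `(z, shift)`
    exact hasLatticeMassGap_of_le (reg.scheme (fun f => P + m f) 0 0) (min_le_right _ _) hL

/-- A finite tuple strictly above `P` is above `P + δ` for some `δ > 0`. [folklore] -/
theorem exists_pos_add_le_all (P : ℝ) (t : Fin Nf → ℝ) (ht : ∀ f, P < t f) :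
    ∃ δ > (0 : ℝ), ∀ f, P + δ ≤ t f := by
  rcases isEmpty_or_nonempty (Fin Nf) with hE | hN
  · exact ⟨1, one_pos, fun f => (hE.false f).elim⟩
  · obtain ⟨f₀, -, hf₀⟩ := Finset.exists_min_image Finset.univ t Finset.univ_nonempty
    exact ⟨t f₀ - P, by linarith [ht f₀], fun f => by linarith [hf₀ f (Finset.mem_univ f)]⟩

/-! ## §2b Gen-2.1 glue (lead a3): the range guard from the per-tuple range (P); E from item 16903 (sorry-free) -/

/-- **The range guard from the per-tuple range (P).**  For `N_f ∈ {2,3}` and a regularisation with X₀ data whose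
bare trajectory is eventually in Lüscher's range at EVERY offset tuple (clause (P) of the gen-2.1 dictionary stub): at
every `t`, eventually `0 ≤ β_k` (asymptotic scaling of any X₀ datum, `β_k → +∞`, landed `deep_tendsto_beta_atTop`) and all
bare masses are `> −1`.  This is clause (R) of the gen-1 dictionary, now DERIVED. [folklore] -/
theorem rangeGuard_of_perTuple (hNf : Nf = 2 ∨ Nf = 3) (reg : QCDRegularisation Nf)
    (hXd : ∀ m : Fin Nf → ℝ, (∀ f, 0 < m f) → ∃ (z shift : QCDField Nf → ℕ → ℝ) (T : OSData (QCDField Nf) 4),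
      IsQCDAlong (reg.scheme m z shift) T ∧ T.IsNontrivial QCDField.glue ∧ T.IsNonGaussian QCDField.glue ∧
        ∀ f g : Fin Nf, f ≠ g → T.IsNontrivial (QCDField.pseudoRe f g))
    (hper : ∀ t : Fin Nf → ℝ, ∀ f, ∀ᶠ k in atTop, -1 < (reg.scheme t 0 0).mq f k) :
    ∀ t : Fin Nf → ℝ, ∀ᶠ k in atTop, 0 ≤ reg.β k ∧ ∀ f, -1 < (reg.scheme t 0 0).mq f k := by
  have hNf16 : Nf ≤ 16 := by rcases hNf with rfl | rfl <;> norm_num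
  -- `β_k → +∞` from the asymptotic scaling of any X₀ datum
  have hβ : ∀ᶠ k in atTop, 0 ≤ reg.β k := by
    obtain ⟨z, shift, T, hA, -⟩ := hXd (fun _ => 1) (fun _ => one_pos)
    have h := Summit.QuantumFields.QCD.Cruxes.WindowExtinction.ChessboardColdCells.deep_tendsto_beta_atTop hNf16
      (reg.scheme (fun _ => 1) z shift) hA.1
    exact (h.eventually_ge_atTop 0).mono fun k hk => hk
  intro t
  exact hβ.and (eventually_all.mpr (hper t))

/-- **E from item 16903.**  For one X₀-honest regularisation at `N_f ∈ {2,3}`: if (hR) the critical mass shifted by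
any negative offset is eventually `> −1`, (hT) lattice-gapped honest data carry a continuum gap, and every tuple above
`P` is lattice-gapped, then every tuple `t` above `P` with a non-positive component carries honest continuum data —
by `EulerDescent.RetypedContinuumComplement` applied to the `m_crit`-shift `shiftReg reg P'`, `P' ∈ (P, min_f t_f)`
(mass scaling and asymptotic scaling transfer; heavy anchor above `1 − P'`; pointwise lattice gaps at all positive
shifted tuples). [folklore] -/
theorem dataBelowZero_of_complement (hNf : Nf = 2 ∨ Nf = 3)
    (h16903 : Summit.QuantumFields.QCD.Theses.EulerDescent.RetypedContinuumComplement)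
    (reg : QCDRegularisation Nf) (hMS : reg.HasMassScaling)
    (hXd : ∀ m : Fin Nf → ℝ, (∀ f, 0 < m f) → ∃ (z shift : QCDField Nf → ℕ → ℝ) (T : OSData (QCDField Nf) 4),
      IsQCDAlong (reg.scheme m z shift) T ∧ T.IsNontrivial QCDField.glue ∧ T.IsNonGaussian QCDField.glue ∧
        ∀ f g : Fin Nf, f ≠ g → T.IsNontrivial (QCDField.pseudoRe f g))
    (hR : ∀ μ : ℝ, μ < 0 → ∀ᶠ k in atTop, (-1 : ℝ) < reg.mcrit k + reg.a k * μ / reg.Zm k)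
    (hT : ∀ (t : Fin Nf → ℝ) (z shift : QCDField Nf → ℕ → ℝ) (T : OSData (QCDField Nf) 4),
      IsQCDAlong (reg.scheme t z shift) T → (∃ Δ > (0 : ℝ), (reg.scheme t 0 0).HasLatticeMassGap Δ) →
        ∃ Δ > (0 : ℝ), T.HasMassGap Δ)
    (P : ℝ) (hP : ∀ t : Fin Nf → ℝ, (∀ f, P < t f) → (∃ Δ > (0 : ℝ), (reg.scheme t 0 0).HasLatticeMassGap Δ))
    (t : Fin Nf → ℝ) (ht : ∀ f, P < t f) (ht0 : ∃ f, t f ≤ 0) :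
    ∃ (z shift : QCDField Nf → ℕ → ℝ) (T : OSData (QCDField Nf) 4),
      IsQCDAlong (reg.scheme t z shift) T ∧ T.IsNontrivial QCDField.glue ∧
        T.IsNonGaussian QCDField.glue ∧
          ∀ f g : Fin Nf, f ≠ g → T.IsNontrivial (QCDField.pseudoRe f g) := by
  have hne : Nonempty (Fin Nf) := by rcases hNf with rfl | rfl <;> exact ⟨0⟩
  obtain ⟨f₀, -, hf₀⟩ := Finset.exists_min_image Finset.univ t Finset.univ_nonempty
  set P' : ℝ := (P + t f₀) / 2 with hP'def
  have hP't : ∀ f, P' < t f := fun f => by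
    have h1 := hf₀ f (Finset.mem_univ f)
    have h2 := ht f₀
    rw [hP'def]; linarith
  have hP'neg : P' < 0 := by
    obtain ⟨f, hf⟩ := ht0
    linarith [hP't f]
  have hPP' : P < P' := by
    have := ht f₀
    rw [hP'def]; linarith
  -- the shifted regularisation and its credentials
  have hAF' : ((shiftReg reg P').scheme 0 0 0).HasAsymptoticScaling := by
    obtain ⟨z, shift, T, hA, -⟩ := hXd (fun _ => 1) (fun _ => one_pos)
    exact hA.1
  have hmc' : ∀ᶠ k in atTop, (-1 : ℝ) < (shiftReg reg P').mcrit k := hR P' hP'neg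
  have hanchor : ∃ Mh : ℝ, 0 < Mh ∧ ∀ m : Fin Nf → ℝ, (∀ f, Mh ≤ m f) →
      ∃ (z shift : QCDField Nf → ℕ → ℝ) (T : OSData (QCDField Nf) 4),
        IsQCDAlong ((shiftReg reg P').scheme m z shift) T ∧ T.IsNontrivial QCDField.glue ∧
          T.IsNonGaussian QCDField.glue ∧ (∀ f g : Fin Nf, f ≠ g → T.IsNontrivial (QCDField.pseudoRe f g)) ∧
            ∃ Δ > 0, T.HasMassGap Δ ∧ ((shiftReg reg P').scheme m z shift).HasLatticeMassGap Δ := by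
    refine ⟨1 - P', by linarith, fun m hm => ?_⟩
    have hpos : ∀ f, 0 < P' + m f := fun f => by linarith [hm f]
    have habP : ∀ f, P < P' + m f := fun f => by linarith [hm f, hpos f]
    obtain ⟨z, shift, T, hA, hN, hG, hPs⟩ := hXd (fun f => P' + m f) hpos
    obtain ⟨Δ₂, hΔ₂, hL⟩ := hP (fun f => P' + m f) habP
    obtain ⟨Δ₁, hΔ₁, hTg⟩ := hT (fun f => P' + m f) z shift T hA ⟨Δ₂, hΔ₂, hL⟩
    refine ⟨z, shift, T, ?_, hN, hG, hPs, min Δ₁ Δ₂, lt_min hΔ₁ hΔ₂,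
      hasMassGap_of_le T (min_le_left _ _) hTg, ?_⟩
    · rw [shiftReg_scheme]; exact hA
    · rw [shiftReg_scheme]
      exact hasLatticeMassGap_of_le (reg.scheme (fun f => P' + m f) 0 0) (min_le_right _ _) hL
  have hgaps : ∀ m : Fin Nf → ℝ, (∀ f, 0 < m f) → ∃ Δ > 0, ((shiftReg reg P').scheme m 0 0).HasLatticeMassGap Δ := by
    intro m hm
    rw [shiftReg_scheme]
    exact hP _ fun f => by linarith [hm f]
  -- 16903 at the positive shifted tuple `t - P'`
  obtain ⟨z, shift, T, hA, hN, hG, hPs, -⟩ :=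
    h16903 Nf hNf (shiftReg reg P') ((shiftReg_hasMassScaling_iff reg P').mpr hMS) hAF' hmc' hanchor hgaps
      (fun f => t f - P') (fun f => by linarith [hP't f])
  refine ⟨z, shift, T, ?_, hN, hG, hPs⟩
  have e : (fun f => P' + (t f - P')) = t := funext fun f => by ring
  rw [shiftReg_scheme, e] at hA
  exact hA

/-! ## §2c Gen-3 glue (lead c14): the fixed-`(k,S)` spectral response from the sigma-term bound (sorry-free) -/

/-- **The spectral-response statement of gen ≤ 2.1, DERIVED** from the sigma-term bound of one regularisation at
`N_f ∈ {2,3}` by the landed reduction `spectralResponse_of_sigmaTermBound` (p143392: continuity of `qcdTransferGap` in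
the bare masses + the barrier lemma; `δ = ε/(2F)`).  `transferGapAt reg (diagTuple Nf ν) k S` and the landed theorem's
`qcdTransferGap Nf (reg.β k) (2S+1) (fun f => (reg.scheme (fun _ => ν) 0 0).mq f k)` agree definitionally.
[cite: ReedSimonIV1978, Thm XIII.1] -/
theorem spectralResponse_of_stub (hNf : Nf = 2 ∨ Nf = 3) (reg : QCDRegularisation Nf)
    (hsigma : ∀ ε > (0 : ℝ), ∃ F > (0 : ℝ), ∃ ρ > (0 : ℝ), ∀ᶠ k in atTop, ∀ S : ℕ, reg.L k ≤ S → ∀ ν ν' : ℝ,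
      0 ≤ reg.β k → (∀ f, -1 < (reg.scheme (diagTuple Nf ν') 0 0).mq f k) → ν' ≤ ν → ν - ν' ≤ ρ →
        ε / 2 * reg.a k ≤ transferGapAt reg (diagTuple Nf ν) k S →
          transferGapAt reg (diagTuple Nf ν) k S - reg.a k * F * (ν - ν') ≤
            transferGapAt reg (diagTuple Nf ν') k S) :
    ∀ ε > (0 : ℝ), ∃ δ > (0 : ℝ), ∀ᶠ k in atTop, ∀ S : ℕ, reg.L k ≤ S → ∀ μ : ℝ,
      0 ≤ reg.β k → (∀ f, -1 < (reg.scheme (diagTuple Nf (μ - δ)) 0 0).mq f k) →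
        ε * reg.a k ≤ transferGapAt reg (diagTuple Nf μ) k S →
          ∀ ν ∈ Set.Icc (μ - δ) μ, ε / 2 * reg.a k ≤ transferGapAt reg (diagTuple Nf ν) k S :=
  spectralResponse_of_sigmaTermBound Nf hNf reg hsigma

/-! ## §3 Openness below from the three light stubs (sorry-free) -/

/-- **Openness below, derived.**  For one regularisation: diagonal domination + spectral response + the spectral
dictionary give the pin's openness input — a UNIFORM rate `ε` at every tuple above `M` forces SOME rate at every tuple
above `M − δ(ε/2)/2`.  Route of the proof: the uniform rate at the degenerate offset `M + δ/2` is a transfer-matrix gap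
`≥ (ε/2)a_k` there (dictionary ⇒); Lüscher's range holds eventually at the lower end `M − δ/2` (dictionary (R));
spectral response spreads `(ε/4)a_k` over `[M − δ/2, M + δ/2]`; the dictionary (⇐) turns that into per-pair rates `ε/8`;
domination lifts the degenerate ray to all tuples. [folklore] -/
theorem diagonal_opensBelow (reg : QCDRegularisation Nf)
    (hdom : ∀ M : ℝ, (∀ μ : ℝ, M < μ → (∃ Δ > (0 : ℝ), (reg.scheme (diagTuple Nf μ) 0 0).HasLatticeMassGap Δ)) →
      ∀ t : Fin Nf → ℝ, (∀ f, M < t f) → (∃ Δ > (0 : ℝ), (reg.scheme t 0 0).HasLatticeMassGap Δ))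
    (hresp : ∀ ε > (0 : ℝ), ∃ δ > (0 : ℝ), ∀ᶠ k in atTop, ∀ S : ℕ, reg.L k ≤ S → ∀ μ : ℝ,
      0 ≤ reg.β k → (∀ f, -1 < (reg.scheme (diagTuple Nf (μ - δ)) 0 0).mq f k) →
        ε * reg.a k ≤ transferGapAt reg (diagTuple Nf μ) k S →
          ∀ ν ∈ Set.Icc (μ - δ) μ, ε / 2 * reg.a k ≤ transferGapAt reg (diagTuple Nf ν) k S)
    (hdict : ∀ t : Fin Nf → ℝ,
      (∀ᶠ k in atTop, 0 ≤ reg.β k ∧ ∀ f, -1 < (reg.scheme t 0 0).mq f k) ∧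
        ∀ ε : ℝ, 0 < ε →
          ((reg.scheme t 0 0).HasLatticeMassGap ε →
              ∀ᶠ k in atTop, ∀ S : ℕ, reg.L k ≤ S → ε / 2 * reg.a k ≤ transferGapAt reg t k S) ∧
            ((∀ᶠ k in atTop, ∀ S : ℕ, reg.L k ≤ S → ε * reg.a k ≤ transferGapAt reg t k S) →
              (reg.scheme t 0 0).HasLatticeMassGap (ε / 2))) :
    ∀ M : ℝ, (∃ ε > (0 : ℝ), ∀ t : Fin Nf → ℝ, (∀ f, M < t f) → (reg.scheme t 0 0).HasLatticeMassGap ε) →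
      ∃ δ > (0 : ℝ), ∀ t : Fin Nf → ℝ, (∀ f, M - δ < t f) → (∃ Δ > (0 : ℝ), (reg.scheme t 0 0).HasLatticeMassGap Δ) := by
  rintro M ⟨ε, hε, huni⟩
  -- response radius for the rate `ε/2`
  obtain ⟨δ, hδ, hev⟩ := hresp (ε / 2) (by positivity)
  -- the uniform rate at the degenerate offset `M + δ/2` is a transfer-matrix gap `≥ (ε/2) a_k`, eventually
  have hstart : ∀ᶠ k in atTop, ∀ S : ℕ, reg.L k ≤ S →
      ε / 2 * reg.a k ≤ transferGapAt reg (diagTuple Nf (M + δ / 2)) k S :=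
    ((hdict (diagTuple Nf (M + δ / 2))).2 ε hε).1 (huni _ fun _ => by
      show M < M + δ / 2
      linarith)
  -- Lüscher's range at the lower end `M - δ/2` of the slab, eventually (dictionary, clause (R))
  have hrange : ∀ᶠ k in atTop, 0 ≤ reg.β k ∧ ∀ f, -1 < (reg.scheme (diagTuple Nf (M - δ / 2)) 0 0).mq f k :=
    (hdict (diagTuple Nf (M - δ / 2))).1
  have e : M + δ / 2 - δ = M - δ / 2 := by ring
  -- spectral response spreads the rate `ε/4` over the degenerate offsets of `[M - δ/2, M + δ/2]`
  have hspread : ∀ᶠ k in atTop, ∀ S : ℕ, reg.L k ≤ S → ∀ ν ∈ Set.Icc (M + δ / 2 - δ) (M + δ / 2),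
      ε / 2 / 2 * reg.a k ≤ transferGapAt reg (diagTuple Nf ν) k S := by
    filter_upwards [hev, hstart, hrange] with k hk hk' hkR S hS ν hν
    exact hk S hS (M + δ / 2) hkR.1 (by rw [e]; exact hkR.2) (hk' S hS) ν hν
  -- the dictionary turns the spread bound into per-pair rates on the slab
  have hslab : ∀ ν ∈ Set.Icc (M + δ / 2 - δ) (M + δ / 2),
      (∃ Δ > (0 : ℝ), (reg.scheme (diagTuple Nf ν) 0 0).HasLatticeMassGap Δ) := by
    intro ν hν
    have h4 : 0 < ε / 2 / 2 := by positivity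
    have hb : ∀ᶠ k in atTop, ∀ S : ℕ, reg.L k ≤ S →
        ε / 2 / 2 * reg.a k ≤ transferGapAt reg (diagTuple Nf ν) k S := by
      filter_upwards [hspread] with k hk S hS
      exact hk S hS ν hν
    exact ⟨ε / 2 / 2 / 2, by positivity, ((hdict (diagTuple Nf ν)).2 (ε / 2 / 2) h4).2 hb⟩
  -- hence every degenerate offset above `M - δ/2` is gapped
  have hdiag : ∀ ν : ℝ, M - δ / 2 < ν → (∃ Δ > (0 : ℝ), (reg.scheme (diagTuple Nf ν) 0 0).HasLatticeMassGap Δ) := by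
    intro ν hν
    rcases le_or_gt ν (M + δ / 2) with hle | hgt
    · exact hslab ν ⟨by linarith, hle⟩
    · exact ⟨ε, hε, huni _ fun _ => by
        show M < ν
        linarith⟩
  -- and domination lifts the degenerate ray to every tuple above `M - δ/2`
  exact ⟨δ / 2, by positivity, hdom (M - δ / 2) hdiag⟩

/-! ## §4 The order-theoretic core with the weak Goldstone input (sorry-free) -/

/- A single NON-gapped tuple gives the weak Goldstone input (so `stub_noUniformFloor` is implied by the card's stub
"Below": any strict lower bound of the components of a non-gapped `t₀` will do).  Kept as an `example` (documentation). -/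
example (reg : QCDRegularisation Nf) {t₀ : Fin Nf → ℝ} (h : ¬ (∃ Δ > (0 : ℝ), (reg.scheme t₀ 0 0).HasLatticeMassGap Δ))
    (L : ℝ) (hL : ∀ f, L < t₀ f) :
    ∃ M₁ : ℝ, ∀ ε > (0 : ℝ), ∃ t : Fin Nf → ℝ, (∀ f, M₁ < t f) ∧ ¬ (reg.scheme t 0 0).HasLatticeMassGap ε :=
  ⟨L, fun ε hε => ⟨t₀, hL, fun hgap => h ⟨ε, hε, hgap⟩⟩⟩

/-- **The pin with the weak Goldstone input.**  If some threshold has every tuple above it gapped (heavy half), the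
rate has no uniform floor above some `M₁` (Goldstone), and uniformly gapped half-lines open below (openness), then some
offset `P` has every tuple above it gapped AND no uniform rate above it.  Either a gapped threshold lies at or below `M₁`
(take it), or the gapped thresholds are bounded below by `M₁` and their infimum works. [folklore] -/
theorem exists_pin_of_noUniformFloor (reg : QCDRegularisation Nf)
    (hne : ∃ M : ℝ, ∀ t : Fin Nf → ℝ, (∀ f, M < t f) → (∃ Δ > (0 : ℝ), (reg.scheme t 0 0).HasLatticeMassGap Δ))
    (hfloor : ∃ M₁ : ℝ, ∀ ε > (0 : ℝ), ∃ t : Fin Nf → ℝ, (∀ f, M₁ < t f) ∧ ¬ (reg.scheme t 0 0).HasLatticeMassGap ε)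
    (hopen : ∀ M : ℝ, (∃ ε > (0 : ℝ), ∀ t : Fin Nf → ℝ, (∀ f, M < t f) → (reg.scheme t 0 0).HasLatticeMassGap ε) →
      ∃ δ > (0 : ℝ), ∀ t : Fin Nf → ℝ, (∀ f, M - δ < t f) → (∃ Δ > (0 : ℝ), (reg.scheme t 0 0).HasLatticeMassGap Δ)) :
    ∃ P : ℝ, (∀ t : Fin Nf → ℝ, (∀ f, P < t f) → (∃ Δ > (0 : ℝ), (reg.scheme t 0 0).HasLatticeMassGap Δ)) ∧
      ∀ ε > (0 : ℝ), ∃ t : Fin Nf → ℝ, (∀ f, P < t f) ∧ ¬ (reg.scheme t 0 0).HasLatticeMassGap ε := by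
  set G : Set ℝ := {M | ∀ t : Fin Nf → ℝ, (∀ f, M < t f) → (∃ Δ > (0 : ℝ), (reg.scheme t 0 0).HasLatticeMassGap Δ)} with hG
  obtain ⟨M₀, hM₀⟩ := hne
  obtain ⟨M₁, hM₁⟩ := hfloor
  have hM₀G : M₀ ∈ G := hM₀
  by_cases hlow : ∃ P ∈ G, P ≤ M₁
  · -- a gapped threshold at or below `M₁`: chirality there is free
    obtain ⟨P, hPG, hPM⟩ := hlow
    refine ⟨P, hPG, fun ε hε => ?_⟩
    obtain ⟨t, ht, hng⟩ := hM₁ ε hε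
    exact ⟨t, fun f => lt_of_le_of_lt hPM (ht f), hng⟩
  · -- otherwise `G` is bounded below by `M₁`; work at its infimum
    push Not at hlow
    have hbdd : BddBelow G := ⟨M₁, fun P hP => (hlow P hP).le⟩
    have hGne : G.Nonempty := ⟨M₀, hM₀G⟩
    set P := sInf G with hP
    have hPG : P ∈ G := by
      intro t ht
      obtain ⟨δ, hδ, hδt⟩ := exists_pos_add_le_all P t ht
      obtain ⟨M, hMG, hMlt⟩ := exists_lt_of_csInf_lt hGne (show P < P + δ by linarith)
      exact hMG t fun f => by linarith [hδt f]
    refine ⟨P, hPG, ?_⟩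
    intro ε hε
    by_contra hcon
    push Not at hcon
    -- `hcon`: a uniform rate `ε` above the infimum; openness gaps a slab below it
    obtain ⟨δ, hδ, hslab⟩ := hopen P ⟨ε, hε, fun t ht => hcon t ht⟩
    have hmem : P - δ / 2 ∈ G := fun t ht => hslab t fun f => by linarith [ht f]
    have := csInf_le hbdd hmem
    linarith

/-- **The E/T-free light package already pins chirality** (the sub-composition that survives restatements R1/R2 verbatim):
from the heavy half, the weak Goldstone input, domination, spectral response and the dictionary — all for ONE honest
regularisation — some `m_crit`-shift of it is chiral at zero and lattice-gapped at every positive tuple. [folklore] -/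
theorem lightPackage_pin (reg : QCDRegularisation Nf)
    (hne : ∃ M : ℝ, ∀ t : Fin Nf → ℝ, (∀ f, M < t f) → (∃ Δ > (0 : ℝ), (reg.scheme t 0 0).HasLatticeMassGap Δ))
    (hfloor : ∃ M₁ : ℝ, ∀ ε > (0 : ℝ), ∃ t : Fin Nf → ℝ, (∀ f, M₁ < t f) ∧ ¬ (reg.scheme t 0 0).HasLatticeMassGap ε)
    (hdom : ∀ M : ℝ, (∀ μ : ℝ, M < μ → (∃ Δ > (0 : ℝ), (reg.scheme (diagTuple Nf μ) 0 0).HasLatticeMassGap Δ)) →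
      ∀ t : Fin Nf → ℝ, (∀ f, M < t f) → (∃ Δ > (0 : ℝ), (reg.scheme t 0 0).HasLatticeMassGap Δ))
    (hresp : ∀ ε > (0 : ℝ), ∃ δ > (0 : ℝ), ∀ᶠ k in atTop, ∀ S : ℕ, reg.L k ≤ S → ∀ μ : ℝ,
      0 ≤ reg.β k → (∀ f, -1 < (reg.scheme (diagTuple Nf (μ - δ)) 0 0).mq f k) →
        ε * reg.a k ≤ transferGapAt reg (diagTuple Nf μ) k S →
          ∀ ν ∈ Set.Icc (μ - δ) μ, ε / 2 * reg.a k ≤ transferGapAt reg (diagTuple Nf ν) k S)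
    (hdict : ∀ t : Fin Nf → ℝ,
      (∀ᶠ k in atTop, 0 ≤ reg.β k ∧ ∀ f, -1 < (reg.scheme t 0 0).mq f k) ∧
        ∀ ε : ℝ, 0 < ε →
          ((reg.scheme t 0 0).HasLatticeMassGap ε →
              ∀ᶠ k in atTop, ∀ S : ℕ, reg.L k ≤ S → ε / 2 * reg.a k ≤ transferGapAt reg t k S) ∧
            ((∀ᶠ k in atTop, ∀ S : ℕ, reg.L k ≤ S → ε * reg.a k ≤ transferGapAt reg t k S) →
              (reg.scheme t 0 0).HasLatticeMassGap (ε / 2))) :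
    ∃ P : ℝ, (shiftReg reg P).IsChiralAtZero ∧
      ∀ t : Fin Nf → ℝ, (∀ f, P < t f) → (∃ Δ > (0 : ℝ), (reg.scheme t 0 0).HasLatticeMassGap Δ) := by
  obtain ⟨P, hPG, hχ⟩ :=
    exists_pin_of_noUniformFloor reg hne hfloor (diagonal_opensBelow reg hdom hresp hdict)
  exact ⟨P, (isChiralAtZero_shiftReg_iff reg P).mpr hχ, hPG⟩

/-! ## §5 The crux from the seven stubs -/

/-- **`QCDOf N_f` for `N_f ∈ {2,3}` from the seven stub statements and X₀** (explicit hypotheses, byte-identical with the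
`stub_*` signatures; sorry-free). [folklore] -/
theorem qcdOf_of_stubs
    (h₁ : Summit.QuantumFields.QCD.Theses.GradientFlowSpecies.MassiveLatticeGap)
    (h₂ : ∀ Nf : ℕ, Nf = 2 ∨ Nf = 3 → ∀ reg : QCDRegularisation Nf, reg.HasMassScaling →
      (∀ m : Fin Nf → ℝ, (∀ f, 0 < m f) → ∃ (z shift : QCDField Nf → ℕ → ℝ) (T : OSData (QCDField Nf) 4),
          IsQCDAlong (reg.scheme m z shift) T ∧ T.IsNontrivial QCDField.glue ∧ T.IsNonGaussian QCDField.glue ∧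
            ∀ f g : Fin Nf, f ≠ g → T.IsNontrivial (QCDField.pseudoRe f g)) →
      ∃ M₁ : ℝ, ∀ ε > (0 : ℝ), ∃ t : Fin Nf → ℝ, (∀ f, M₁ < t f) ∧ ¬ (reg.scheme t 0 0).HasLatticeMassGap ε)
    (h₃ : ∀ Nf : ℕ, Nf = 2 ∨ Nf = 3 → ∀ reg : QCDRegularisation Nf, reg.HasMassScaling →
      (∀ m : Fin Nf → ℝ, (∀ f, 0 < m f) → ∃ (z shift : QCDField Nf → ℕ → ℝ) (T : OSData (QCDField Nf) 4),
          IsQCDAlong (reg.scheme m z shift) T ∧ T.IsNontrivial QCDField.glue ∧ T.IsNonGaussian QCDField.glue ∧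
            ∀ f g : Fin Nf, f ≠ g → T.IsNontrivial (QCDField.pseudoRe f g)) →
      ∀ M : ℝ, (∀ μ : ℝ, M < μ → (∃ Δ > (0 : ℝ), (reg.scheme (diagTuple Nf μ) 0 0).HasLatticeMassGap Δ)) →
        ∀ t : Fin Nf → ℝ, (∀ f, M < t f) → (∃ Δ > (0 : ℝ), (reg.scheme t 0 0).HasLatticeMassGap Δ))
    (h₄ : ∀ Nf : ℕ, Nf = 2 ∨ Nf = 3 → ∀ reg : QCDRegularisation Nf, reg.HasMassScaling →
      (∀ m : Fin Nf → ℝ, (∀ f, 0 < m f) → ∃ (z shift : QCDField Nf → ℕ → ℝ) (T : OSData (QCDField Nf) 4),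
          IsQCDAlong (reg.scheme m z shift) T ∧ T.IsNontrivial QCDField.glue ∧ T.IsNonGaussian QCDField.glue ∧
            ∀ f g : Fin Nf, f ≠ g → T.IsNontrivial (QCDField.pseudoRe f g)) →
      ∀ ε > (0 : ℝ), ∃ F > (0 : ℝ), ∃ ρ > (0 : ℝ), ∀ᶠ k in atTop, ∀ S : ℕ, reg.L k ≤ S → ∀ ν ν' : ℝ,
        0 ≤ reg.β k → (∀ f, -1 < (reg.scheme (diagTuple Nf ν') 0 0).mq f k) → ν' ≤ ν → ν - ν' ≤ ρ →
          ε / 2 * reg.a k ≤ transferGapAt reg (diagTuple Nf ν) k S →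
            transferGapAt reg (diagTuple Nf ν) k S - reg.a k * F * (ν - ν') ≤
              transferGapAt reg (diagTuple Nf ν') k S)
    (h₅ : ∀ Nf : ℕ, Nf = 2 ∨ Nf = 3 → ∀ reg : QCDRegularisation Nf, reg.HasMassScaling →
      (∀ m : Fin Nf → ℝ, (∀ f, 0 < m f) → ∃ (z shift : QCDField Nf → ℕ → ℝ) (T : OSData (QCDField Nf) 4),
          IsQCDAlong (reg.scheme m z shift) T ∧ T.IsNontrivial QCDField.glue ∧ T.IsNonGaussian QCDField.glue ∧
            ∀ f g : Fin Nf, f ≠ g → T.IsNontrivial (QCDField.pseudoRe f g)) →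
      (∀ t : Fin Nf → ℝ, ∀ f, ∀ᶠ k in atTop, -1 < (reg.scheme t 0 0).mq f k) ∧
        ∀ t : Fin Nf → ℝ, ∀ ε : ℝ, 0 < ε →
          ((reg.scheme t 0 0).HasLatticeMassGap ε →
              ∀ᶠ k in atTop, ∀ S : ℕ, reg.L k ≤ S → ε / 2 * reg.a k ≤ transferGapAt reg t k S) ∧
            ((∀ᶠ k in atTop, ∀ S : ℕ, reg.L k ≤ S → ε * reg.a k ≤ transferGapAt reg t k S) →
              (reg.scheme t 0 0).HasLatticeMassGap (ε / 2)))
    (h₆ : Summit.QuantumFields.QCD.Theses.EulerDescent.RetypedContinuumComplement)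
    (h₇ : ∀ Nf : ℕ, Nf = 2 ∨ Nf = 3 → ∀ reg : QCDRegularisation Nf, reg.HasMassScaling →
      (∀ m : Fin Nf → ℝ, (∀ f, 0 < m f) → ∃ (z shift : QCDField Nf → ℕ → ℝ) (T : OSData (QCDField Nf) 4),
          IsQCDAlong (reg.scheme m z shift) T ∧ T.IsNontrivial QCDField.glue ∧ T.IsNonGaussian QCDField.glue ∧
            ∀ f g : Fin Nf, f ≠ g → T.IsNontrivial (QCDField.pseudoRe f g)) →
      ∀ (t : Fin Nf → ℝ) (z shift : QCDField Nf → ℕ → ℝ) (T : OSData (QCDField Nf) 4),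
        IsQCDAlong (reg.scheme t z shift) T → (∃ Δ > (0 : ℝ), (reg.scheme t 0 0).HasLatticeMassGap Δ) →
          ∃ Δ > (0 : ℝ), T.HasMassGap Δ)
    (hX : ContinuumQCDExists) : ∀ Nf : ℕ, Nf = 2 ∨ Nf = 3 → QCDOf Nf := by
  intro Nf hNf
  obtain ⟨reg, hMS, hXd⟩ := hX Nf hNf
  -- heavy half: the gapped thresholds are non-empty
  have hne : ∃ M : ℝ, ∀ t : Fin Nf → ℝ, (∀ f, M < t f) → (∃ Δ > (0 : ℝ), (reg.scheme t 0 0).HasLatticeMassGap Δ) := by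
    obtain ⟨M, hM⟩ := h₁ Nf hNf reg ⟨hMS, hXd⟩
    exact ⟨M, fun t ht => hM t ht⟩
  -- gen 2.1: the per-tuple range (P) of the dictionary stub gives the range guard at every offset tuple
  obtain ⟨hper, hdict'⟩ := h₅ Nf hNf reg hMS hXd
  have hrange := rangeGuard_of_perTuple hNf reg hXd hper
  -- the pin (light package: Goldstone floor, domination, spectral response — gen 3: DERIVED from the sigma-term
  -- bound by the landed reduction p143392 —, dictionary)
  obtain ⟨P, hχ, habove⟩ :=
    lightPackage_pin reg hne (h₂ Nf hNf reg hMS hXd) (h₃ Nf hNf reg hMS hXd)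
      (spectralResponse_of_stub hNf reg (h₄ Nf hNf reg hMS hXd)) (fun t => ⟨hrange t, hdict' t⟩)
  -- (hR) of the E-glue: the range guard at the degenerate negative offsets
  have hR : ∀ μ : ℝ, μ < 0 → ∀ᶠ k in atTop, (-1 : ℝ) < reg.mcrit k + reg.a k * μ / reg.Zm k := by
    intro μ _
    have hne' : Nonempty (Fin Nf) := by rcases hNf with rfl | rfl <;> exact ⟨0⟩
    obtain ⟨f₀⟩ := hne'
    filter_upwards [hrange (diagTuple Nf μ)] with k hk
    exact hk.2 f₀
  -- the data above the pin: X₀ above zero, E (16903 by name) below, T for the continuum gap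
  refine qcdOf_of_pin reg hMS P hχ fun t ht => ?_
  have hL : (∃ Δ > (0 : ℝ), (reg.scheme t 0 0).HasLatticeMassGap Δ) := habove t ht
  by_cases hpos : ∀ f, 0 < t f
  · obtain ⟨z, shift, T, hA, hN, hG, hPs⟩ := hXd t hpos
    exact ⟨z, shift, T, hA, hN, hG, hPs, h₇ Nf hNf reg hMS hXd t z shift T hA hL, hL⟩
  · push Not at hpos
    obtain ⟨z, shift, T, hA, hN, hG, hPs⟩ :=
      dataBelowZero_of_complement hNf h₆ reg hMS hXd hR (h₇ Nf hNf reg hMS hXd) P habove t ht hpos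
    exact ⟨z, shift, T, hA, hN, hG, hPs, h₇ Nf hNf reg hMS hXd t z shift T hA hL, hL⟩

/-- **The crux BY NAME from the registered stubs** (the skeleton's composition; the only theorem of this file whose
conclusion is the crux; sorries only inside `stub_*`). [folklore] -/
theorem RobustYangMillsHandover_of :
    Summit.QuantumFields.QCD.Theses.HeatSlicedQuarks.RobustYangMillsHandover := fun hX =>
  ⟨qcdOf_of_stubs stub_heavyHalf stub_noUniformFloor stub_diagDom stub_sigmaTermBound stub_spectralDictionary
      stub_dataBelowZero stub_gapTransfer hX 2 (Or.inl rfl),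
    qcdOf_of_stubs stub_heavyHalf stub_noUniformFloor stub_diagDom stub_sigmaTermBound stub_spectralDictionary
      stub_dataBelowZero stub_gapTransfer hX 3 (Or.inr rfl)⟩

end Summit.QuantumFields.QCD.Cruxes.RobustYangMillsHandover.PinTheInfimum
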